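import Mathlib.Analysis.SpecialFunctions.Complex.Circle
import Mathlib.Topology.Order.IntermediateValue
import HarnessLib

/-!
# A product of two Euler factors with free phases takes every nearby value exactly

Topic `Literature/Analysis/Complex` (namespace `Literature.Analysis.Complex`). Everything here is
PROVED; it is elementary plane geometry ("a little high school geometry", in the manner of Bohr's
addition of convex curves, Titchmarsh, *The Theory of the Riemann Zeta-Function*, §11.5–11.6) in
the MULTIPLICATIVE form needed to steer a finite Euler product `∏_p (1 - b_p p^{-s})⁻¹` to a
prescribed value EXACTLY: the two local factors at two primes `q₁ < q₂` with free unimodular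
phases `u₁, u₂` already produce every value in a neighbourhood of relative size `≍ q₁^{-σ}`.

* `Literature.Analysis.Complex.exists_unimodular_prod_one_sub_eq` — if `0 < r₁ ≤ 1/10`,
  `r₁/2 ≤ r₂ ≤ r₁` and `| |ω - 1| - r₁ | ≤ r₁/4`, there are `u₁, u₂` with `|u₁| = |u₂| = 1` and
  `(1 - r₁ u₁)(1 - r₂ u₂) = ω`.

Proof: with `ξ = ω - 1 ≠ 0`, `ξ̂ = ξ/|ξ|` and `u₁ = ξ̂ e^{iθ}`, the function
`F(θ) = |ξ + r₁ u₁| - r₂ |1 - r₁ u₁|` is continuous, `F(0) ≥ |ξ| - r₁² > 0` and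
`F(π) ≤ | |ξ| - r₁ | - r₂ (1 - r₁) < 0`, so `F(θ) = 0` for some `θ ∈ [0, π]` (intermediate value
theorem); then `u₂ = -(ξ + r₁u₁)/(r₂ (1 - r₁u₁))` is unimodular and
`(1 - r₁u₁)(1 - r₂u₂) = (1 - r₁u₁) + (ξ + r₁u₁) = ω`.

## References

* [Titchmarsh1986] E. C. Titchmarsh, *The Theory of the Riemann Zeta-Function*, 2nd ed., §11.5
  (sums of circles) and §11.6 (the curves `-log(1 - z)`, `|z| = p^{-σ}`).
-/

noncomputable section

open Complex Set

namespace Literature.Analysis.Complex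

namespace ProductOfTwoCircles

/-- For a unit vector `v` and real `c`: `‖ξ + c v‖ = |‖ξ‖ + c|` when `v = ξ/‖ξ‖`. [folklore] -/
theorem norm_add_mul_unit {ξ : ℂ} (hξ : ξ ≠ 0) (c : ℝ) :
    ‖ξ + c * (ξ / (‖ξ‖ : ℂ))‖ = |‖ξ‖ + c| := by
  have hn : (‖ξ‖ : ℂ) ≠ 0 := by exact_mod_cast (norm_ne_zero_iff.2 hξ)
  have e : ξ + c * (ξ / (‖ξ‖ : ℂ)) = ((‖ξ‖ + c : ℝ) : ℂ) * (ξ / (‖ξ‖ : ℂ)) := by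
    push_cast
    field_simp
  rw [e, norm_mul, Complex.norm_real, Real.norm_eq_abs, norm_div, Complex.norm_real,
    Real.norm_eq_abs, abs_of_pos (norm_pos_iff.2 hξ), div_self (norm_ne_zero_iff.2 hξ), mul_one]

end ProductOfTwoCircles

open ProductOfTwoCircles in
/-- **Two Euler factors with free phases cover a neighbourhood exactly.** Let `0 < r₁ ≤ 1/10`,
`r₁/2 ≤ r₂ ≤ r₁`, and let `ω ∈ ℂ` satisfy `| |ω - 1| - r₁ | ≤ r₁/4`. Then there are unimodular
`u₁, u₂` with `(1 - r₁ u₁)(1 - r₂ u₂) = ω`. (Intermediate value theorem for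
`θ ↦ |ξ + r₁ξ̂e^{iθ}| - r₂|1 - r₁ξ̂e^{iθ}|`, `ξ = ω - 1`.)
[cite: Titchmarsh1986, §11.5–11.6] -/
theorem exists_unimodular_prod_one_sub_eq {r₁ r₂ : ℝ} (hr₁ : 0 < r₁) (hr₁' : r₁ ≤ 1 / 10)
    (hr₂ : r₁ / 2 ≤ r₂) (hr₂' : r₂ ≤ r₁) {ω : ℂ} (hω : |‖ω - 1‖ - r₁| ≤ r₁ / 4) :
    ∃ u₁ u₂ : ℂ, ‖u₁‖ = 1 ∧ ‖u₂‖ = 1 ∧ (1 - r₁ * u₁) * (1 - r₂ * u₂) = ω := by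
  -- `ξ = ω - 1 ≠ 0`, the unit vector `ξ̂` and the phase curve `u(θ) = ξ̂ e^{iθ}`
  obtain ⟨ξ, hξ⟩ : ∃ ξ : ℂ, ξ = ω - 1 := ⟨_, rfl⟩
  rw [← hξ] at hω
  have hξn : 3 * r₁ / 4 ≤ ‖ξ‖ := by
    have := (abs_le.1 hω).1; linarith
  have hξn' : ‖ξ‖ ≤ 5 * r₁ / 4 := by
    have := (abs_le.1 hω).2; linarith
  have hξ0 : ξ ≠ 0 := by
    intro h; rw [h, norm_zero] at hξn; linarith
  have hr₂0 : 0 < r₂ := by linarith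
  obtain ⟨v, hv⟩ : ∃ v : ℂ, v = ξ / (‖ξ‖ : ℂ) := ⟨_, rfl⟩
  have hvn : ‖v‖ = 1 := by
    rw [hv, norm_div, Complex.norm_real, Real.norm_eq_abs, abs_of_pos (norm_pos_iff.2 hξ0),
      div_self (norm_ne_zero_iff.2 hξ0)]
  obtain ⟨u, hu⟩ : ∃ u : ℝ → ℂ, u = fun θ : ℝ ↦ v * exp ((θ : ℂ) * I) := ⟨_, rfl⟩
  have hun : ∀ θ, ‖u θ‖ = 1 := fun θ ↦ by
    rw [hu]; simp [hvn, Complex.norm_exp_ofReal_mul_I]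
  have huc : Continuous u := by rw [hu]; fun_prop
  -- the function `F`
  obtain ⟨F, hF⟩ : ∃ F : ℝ → ℝ, F = fun θ ↦ ‖ξ + r₁ * u θ‖ - r₂ * ‖1 - r₁ * u θ‖ := ⟨_, rfl⟩
  have hFc : Continuous F := by rw [hF]; fun_prop
  -- `F 0 > 0`
  have hu0 : u 0 = v := by rw [hu]; simp
  have hF0 : 0 < F 0 := by
    have h1 : ‖ξ + r₁ * u 0‖ = ‖ξ‖ + r₁ := by
      rw [hu0, hv, norm_add_mul_unit hξ0, abs_of_pos (by positivity)]
    have h2 : ‖1 - r₁ * u 0‖ ≤ 1 + r₁ := by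
      calc ‖1 - r₁ * u 0‖ ≤ ‖(1 : ℂ)‖ + ‖(r₁ : ℂ) * u 0‖ := norm_sub_le _ _
        _ = 1 + r₁ := by
          rw [norm_one, norm_mul, hun, mul_one, Complex.norm_real, Real.norm_eq_abs,
            abs_of_pos hr₁]
    have h3 : r₂ * ‖1 - r₁ * u 0‖ ≤ r₁ * (1 + r₁) :=
      (mul_le_mul_of_nonneg_left h2 hr₂0.le).trans (mul_le_mul_of_nonneg_right hr₂' (by linarith))
    rw [hF]
    show 0 < ‖ξ + r₁ * u 0‖ - r₂ * ‖1 - r₁ * u 0‖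
    rw [h1]
    nlinarith
  -- `F π < 0`
  have huπ : u Real.pi = -v := by rw [hu]; simp [Complex.exp_pi_mul_I]
  have hFπ : F Real.pi < 0 := by
    have h1 : ‖ξ + r₁ * u Real.pi‖ = |‖ξ‖ - r₁| := by
      have e : ξ + r₁ * u Real.pi = ξ + ((-r₁ : ℝ) : ℂ) * (ξ / (‖ξ‖ : ℂ)) := by
        rw [huπ, hv]; push_cast; ring
      rw [e, norm_add_mul_unit hξ0 (-r₁), ← sub_eq_add_neg]
    have h2 : 1 - r₁ ≤ ‖1 - r₁ * u Real.pi‖ := by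
      have := norm_sub_norm_le (1 : ℂ) ((r₁ : ℂ) * u Real.pi)
      rwa [norm_one, norm_mul, hun, mul_one, Complex.norm_real, Real.norm_eq_abs,
        abs_of_pos hr₁] at this
    have h3 : r₂ * (1 - r₁) ≤ r₂ * ‖1 - r₁ * u Real.pi‖ := mul_le_mul_of_nonneg_left h2 hr₂0.le
    have h4 : |‖ξ‖ - r₁| ≤ r₁ / 4 := hω
    rw [hF]
    show ‖ξ + r₁ * u Real.pi‖ - r₂ * ‖1 - r₁ * u Real.pi‖ < 0
    rw [h1]
    nlinarith
  -- a zero `θ₀ ∈ [0, π]` of `F`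
  obtain ⟨θ₀, -, hθ₀⟩ : ∃ θ₀ ∈ Icc (0 : ℝ) Real.pi, F θ₀ = 0 :=
    intermediate_value_Icc' Real.pi_pos.le hFc.continuousOn ⟨hFπ.le, hF0.le⟩
  -- the phases
  have hD : (1 : ℂ) - r₁ * u θ₀ ≠ 0 := by
    intro h
    have : ‖(r₁ : ℂ) * u θ₀‖ = 1 := by rw [← sub_eq_zero.1 h, norm_one]
    rw [norm_mul, hun, mul_one, Complex.norm_real, Real.norm_eq_abs, abs_of_pos hr₁] at this
    linarith
  have hzero : ‖ξ + r₁ * u θ₀‖ = r₂ * ‖1 - r₁ * u θ₀‖ := by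
    have : F θ₀ = ‖ξ + r₁ * u θ₀‖ - r₂ * ‖1 - r₁ * u θ₀‖ := by rw [hF]
    linarith
  refine ⟨u θ₀, -(ξ + r₁ * u θ₀) / (r₂ * (1 - r₁ * u θ₀)), hun θ₀, ?_, ?_⟩
  · rw [norm_div, norm_neg, hzero, norm_mul, Complex.norm_real, Real.norm_eq_abs,
      abs_of_pos hr₂0, div_self]
    exact mul_ne_zero hr₂0.ne' (norm_ne_zero_iff.2 hD)
  · have hr₂c : (r₂ : ℂ) ≠ 0 := by exact_mod_cast hr₂0.ne'
    rw [show ω = ξ + 1 by rw [hξ]; ring]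
    field_simp
    ring
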